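import Mathlib
import Literature.Analysis.FluidPDE.VectorCalculus
import Summits.NavierStokesRegularity.NavierStokesRegularity.Theorems.FilamentSkeletonRssClause13RAdjointPunctured

/-!
# Clause 13-R, STUB R at MODEL level: UNIQUENESS of the edge-measure density in the PUNCTURED class
# (crux `Clause13RNearStraightL`, stmt-NavierStokesRegularity-23612; line `rate_bordered_split`, STUB R `stub_rateRow13RFlat`)

Route `FilamentSkeletonRss`, Variant A1R.  `…Clause13REdgeMeasureModelConverse.edgeMeasure_density_unique` (p829291) proves that two `C¹`
solutions on the ball `S = [a, b]` of the SOURCED model adjoint equation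
  `cst • (m σ • (φ σ × d) − ∫_{τ∈S} k(τ−σ) • (φ τ × d) dτ) + ½ φ σ + α e × φ σ + w′(σ) φ σ + w(σ) φ′(σ) = h σ`
coincide, so that the repaired census item (c′) («existence and size of the edge-sourced density») is a pure existence question.  But the
density part of an annihilating measure is a priori NOT `C¹` through the waist station `c` (`w(c) = 0`): the local classification
(`…Clause13RAdjointWaistSourced`, p831138) only makes it the bounded waist-regular branch on each punctured half-ball.  THIS FILE lifts
the uniqueness to that class, using the punctured annihilator theorems of `…Clause13RAdjointPunctured`:
* `sourced_density_unique_of_bounded` — two solutions of the sourced equation (ANY source `h`, no regularity assumed on it) on `S ∖ {c}`,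
  each differentiable on `S ∖ {c}` and bounded on `S`, coincide on `S ∖ {c}` (`a < c < b`, `w(c) = 0`, `w(a) ≤ 0 ≤ w(b)`, `w′ ≥ −1 + 2ε`);
* `sourced_density_unique_of_integrableOn` — the same for INTEGRABLE solutions under the two-sided linear opening of the slip at `c`.
So at model level the edge data `(e₊, e₋)` determine the interior density uniquely within the realistic (`L¹`) class: (c′) remains a pure
EXISTENCE-and-size question there too.  [folklore] (linearity + the punctured energy identity).
Hand `leafhand-ns-filamentskeletonrs-19-g1` (LAND-ONLY); `--supports stmt-NavierStokesRegularity-23612` helper, def-free.  HONEST FRAMING: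
bookkeeping for the MODEL adjoint equation attached to a HYPOTHETICAL filament skeleton on the NEGATIVE side of a MODEL blow-up route;
STUB R is NOT proved here and nothing in this file bears on Navier–Stokes regularity or blow-up.
-/

noncomputable section

open MeasureTheory Filter Topology Set intervalIntegral
open scoped RealInnerProductSpace InnerProductSpace
open Literature.Analysis.FluidPDE
open Summit.NavierStokesRegularity.NavierStokesRegularity.Theorems.Clause13RAdjointNonlocalBounded
open Summit.NavierStokesRegularity.NavierStokesRegularity.Theorems.Clause13RAdjointPunctured

namespace Summit.NavierStokesRegularity.NavierStokesRegularity.Theorems.Clause13RAdjointPuncturedUnique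
set_option linter.dupNamespace false

/-! ## §1 Integrability of the nonlocal integrand and linearity of the equation -/

/-- For a weight a.e.-measurable and bounded on `S`, the nonlocal integrand `τ ↦ k(τ−σ) • (φ τ × d)` is integrable on `S`. [folklore] -/
theorem integrableOn_nonlocal_integrand_of_bounded {a b M : ℝ} {k : ℝ → ℝ} (hk : Continuous k)
    {φ : ℝ → EuclideanSpace ℝ (Fin 3)} (hφm : AEStronglyMeasurable φ (volume.restrict (Icc a b)))
    (hM : ∀ τ ∈ Icc a b, ‖φ τ‖ ≤ M) (d : EuclideanSpace ℝ (Fin 3)) (σ : ℝ) :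
    IntegrableOn (fun τ => k (τ - σ) • cross (φ τ) d) (Icc a b) := by
  have hcx : ∀ x : EuclideanSpace ℝ (Fin 3), ‖cross x d‖ ≤ ‖x‖ * ‖d‖ := fun x => by
    rw [norm_cross]; nlinarith [Real.sin_le_one (InnerProductGeometry.angle x d), mul_nonneg (norm_nonneg x) (norm_nonneg d)]
  obtain ⟨K, hK⟩ := (isCompact_Icc (a := a - σ) (b := b - σ)).exists_bound_of_continuousOn hk.continuousOn
  have hmeas : AEStronglyMeasurable (fun τ => k (τ - σ) • cross (φ τ) d) (volume.restrict (Icc a b)) :=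
    ((hk.comp (continuous_id.sub continuous_const)).aestronglyMeasurable).smul
      ((continuous_cross_left d).comp_aestronglyMeasurable hφm)
  refine Integrable.mono' (integrable_const (max K 0 * (M * ‖d‖))) hmeas ?_
  filter_upwards [ae_restrict_mem measurableSet_Icc] with τ hτ
  rw [norm_smul]
  have hkτ : ‖k (τ - σ)‖ ≤ max K 0 := (hK _ ⟨by linarith [hτ.1], by linarith [hτ.2]⟩).trans (le_max_left _ _)
  exact mul_le_mul hkτ ((hcx _).trans (mul_le_mul_of_nonneg_right (hM τ hτ) (norm_nonneg _))) (norm_nonneg _)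
    (le_max_right _ _)

/-- For a weight integrable on `S`, the nonlocal integrand is integrable on `S`. [folklore] -/
theorem integrableOn_nonlocal_integrand_of_integrableOn {a b : ℝ} {k : ℝ → ℝ} (hk : Continuous k)
    {φ : ℝ → EuclideanSpace ℝ (Fin 3)} (hint : IntegrableOn φ (Icc a b)) (d : EuclideanSpace ℝ (Fin 3)) (σ : ℝ) :
    IntegrableOn (fun τ => k (τ - σ) • cross (φ τ) d) (Icc a b) := by
  have hL : IntegrableOn (fun τ => cross (φ τ) d) (Icc a b) := by
    have h := ContinuousLinearMap.integrable_comp (crossCLM.flip d) hint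
    refine h.congr (Eventually.of_forall fun τ => ?_)
    simp only [ContinuousLinearMap.flip_apply, crossCLM_apply]
  exact hL.continuousOn_smul (hk.comp (continuous_id.sub continuous_const)).continuousOn isCompact_Icc

/-- **Linearity**: the difference of two solutions of the SOURCED equation (same source) solves the homogeneous equation, as soon as both
nonlocal integrands are integrable. [folklore] -/
theorem difference_solves_homogeneous {a b cst α : ℝ} {k m w w' : ℝ → ℝ} {φ₁ φ₁' φ₂ φ₂' : ℝ → EuclideanSpace ℝ (Fin 3)}
    {d e hsrc : EuclideanSpace ℝ (Fin 3)} {σ : ℝ}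
    (hi₁ : IntegrableOn (fun τ => k (τ - σ) • cross (φ₁ τ) d) (Icc a b))
    (hi₂ : IntegrableOn (fun τ => k (τ - σ) • cross (φ₂ τ) d) (Icc a b))
    (h₁ : cst • (m σ • cross (φ₁ σ) d - ∫ τ in Icc a b, k (τ - σ) • cross (φ₁ τ) d)
        + (1 / 2 : ℝ) • φ₁ σ + α • cross e (φ₁ σ) + w' σ • φ₁ σ + w σ • φ₁' σ = hsrc)
    (h₂ : cst • (m σ • cross (φ₂ σ) d - ∫ τ in Icc a b, k (τ - σ) • cross (φ₂ τ) d)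
        + (1 / 2 : ℝ) • φ₂ σ + α • cross e (φ₂ σ) + w' σ • φ₂ σ + w σ • φ₂' σ = hsrc) :
    cst • (m σ • cross (φ₁ σ - φ₂ σ) d - ∫ τ in Icc a b, k (τ - σ) • cross (φ₁ τ - φ₂ τ) d)
        + (1 / 2 : ℝ) • (φ₁ σ - φ₂ σ) + α • cross e (φ₁ σ - φ₂ σ) + w' σ • (φ₁ σ - φ₂ σ)
        + w σ • (φ₁' σ - φ₂' σ) = 0 := by
  have hcsub : ∀ x y z : EuclideanSpace ℝ (Fin 3), cross (x - y) z = cross x z - cross y z := fun x y z => by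
    rw [← crossCLM_apply, ← crossCLM_apply, ← crossCLM_apply, map_sub]; rfl
  have hcsub' : ∀ z x y : EuclideanSpace ℝ (Fin 3), cross z (x - y) = cross z x - cross z y := fun z x y => by
    rw [← crossCLM_apply, ← crossCLM_apply, ← crossCLM_apply, map_sub]
  have hI : ∫ τ in Icc a b, k (τ - σ) • cross (φ₁ τ - φ₂ τ) d
      = (∫ τ in Icc a b, k (τ - σ) • cross (φ₁ τ) d) - ∫ τ in Icc a b, k (τ - σ) • cross (φ₂ τ) d := by
    rw [← integral_sub hi₁ hi₂]
    refine integral_congr_ae (Eventually.of_forall fun τ => ?_)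
    simp only [hcsub, smul_sub]
  rw [hI, hcsub, hcsub']
  have : cst • (m σ • (cross (φ₁ σ) d - cross (φ₂ σ) d)
        - ((∫ τ in Icc a b, k (τ - σ) • cross (φ₁ τ) d) - ∫ τ in Icc a b, k (τ - σ) • cross (φ₂ τ) d))
      + (1 / 2 : ℝ) • (φ₁ σ - φ₂ σ) + α • (cross e (φ₁ σ) - cross e (φ₂ σ)) + w' σ • (φ₁ σ - φ₂ σ) + w σ • (φ₁' σ - φ₂' σ)
      = (cst • (m σ • cross (φ₁ σ) d - ∫ τ in Icc a b, k (τ - σ) • cross (φ₁ τ) d)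
          + (1 / 2 : ℝ) • φ₁ σ + α • cross e (φ₁ σ) + w' σ • φ₁ σ + w σ • φ₁' σ)
        - (cst • (m σ • cross (φ₂ σ) d - ∫ τ in Icc a b, k (τ - σ) • cross (φ₂ τ) d)
          + (1 / 2 : ℝ) • φ₂ σ + α • cross e (φ₂ σ) + w' σ • φ₂ σ + w σ • φ₂' σ) := by
    module
  rw [this, h₁, h₂, sub_self]

/-! ## §2 Uniqueness of the density in the punctured classes -/

/-- **UNIQUENESS OF THE EDGE-MEASURE DENSITY — bounded punctured class.**  On `S = [a, b]` with `a < c < b`, slip `w ∈ C¹(ℝ)` with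
`w(c) = 0`, `w(a) ≤ 0 ≤ w(b)`, `w′ ≥ −1 + 2ε` (`ε > 0`), continuous even kernel `k`: two solutions `φ₁, φ₂` of the SOURCED model adjoint
equation with the same (arbitrary) source `h` at every station of `S ∖ {c}`, each differentiable on `S ∖ {c}` and bounded on `S`, coincide
on `S ∖ {c}`. [folklore] -/
theorem sourced_density_unique_of_bounded {a b c cst α ε M₁ M₂ : ℝ} (hac : a < c) (hcb : c < b) (hε : 0 < ε)
    {k m w w' : ℝ → ℝ} {φ₁ φ₁' φ₂ φ₂' h : ℝ → EuclideanSpace ℝ (Fin 3)} {d e : EuclideanSpace ℝ (Fin 3)}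
    (hk : Continuous k) (hkev : ∀ s, k (-s) = k s)
    (hw : ∀ σ, HasDerivAt w (w' σ) σ) (hw'c : Continuous w') (hwc0 : w c = 0)
    (hwa : w a ≤ 0) (hwb : 0 ≤ w b) (hgrowth : ∀ σ ∈ Icc a b, -1 + 2 * ε ≤ w' σ)
    (hφ₁ : ∀ σ ∈ Icc a b, σ ≠ c → HasDerivAt φ₁ (φ₁' σ) σ) (hb₁ : ∀ σ ∈ Icc a b, ‖φ₁ σ‖ ≤ M₁)
    (hφ₂ : ∀ σ ∈ Icc a b, σ ≠ c → HasDerivAt φ₂ (φ₂' σ) σ) (hb₂ : ∀ σ ∈ Icc a b, ‖φ₂ σ‖ ≤ M₂)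
    (h₁ : ∀ σ ∈ Icc a b, σ ≠ c →
      cst • (m σ • cross (φ₁ σ) d - ∫ τ in Icc a b, k (τ - σ) • cross (φ₁ τ) d)
        + (1 / 2 : ℝ) • φ₁ σ + α • cross e (φ₁ σ) + w' σ • φ₁ σ + w σ • φ₁' σ = h σ)
    (h₂ : ∀ σ ∈ Icc a b, σ ≠ c →
      cst • (m σ • cross (φ₂ σ) d - ∫ τ in Icc a b, k (τ - σ) • cross (φ₂ τ) d)
        + (1 / 2 : ℝ) • φ₂ σ + α • cross e (φ₂ σ) + w' σ • φ₂ σ + w σ • φ₂' σ = h σ) :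
    ∀ σ ∈ Icc a b, σ ≠ c → φ₁ σ = φ₂ σ := by
  have hm₁ := aestronglyMeasurable_of_hasDerivAt_off hφ₁
  have hm₂ := aestronglyMeasurable_of_hasDerivAt_off hφ₂
  have hφ : ∀ σ ∈ Icc a b, σ ≠ c → HasDerivAt (fun σ => φ₁ σ - φ₂ σ) (φ₁' σ - φ₂' σ) σ :=
    fun σ hσ hσc => (hφ₁ σ hσ hσc).sub (hφ₂ σ hσ hσc)
  have hbdd : ∀ σ ∈ Icc a b, ‖φ₁ σ - φ₂ σ‖ ≤ M₁ + M₂ :=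
    fun σ hσ => (norm_sub_le _ _).trans (add_le_add (hb₁ σ hσ) (hb₂ σ hσ))
  have heq : ∀ σ ∈ Icc a b, σ ≠ c →
      cst • (m σ • cross (φ₁ σ - φ₂ σ) d - ∫ τ in Icc a b, k (τ - σ) • cross (φ₁ τ - φ₂ τ) d)
        + (1 / 2 : ℝ) • (φ₁ σ - φ₂ σ) + α • cross e (φ₁ σ - φ₂ σ) + w' σ • (φ₁ σ - φ₂ σ)
        + w σ • (φ₁' σ - φ₂' σ) = 0 :=
    fun σ hσ hσc => difference_solves_homogeneous
      (integrableOn_nonlocal_integrand_of_bounded hk hm₁ hb₁ d σ)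
      (integrableOn_nonlocal_integrand_of_bounded hk hm₂ hb₂ d σ) (h₁ σ hσ hσc) (h₂ σ hσ hσc)
  have hz := model_adjoint_no_bounded_punctured_annihilator (φ := fun σ => φ₁ σ - φ₂ σ)
    (φ' := fun σ => φ₁' σ - φ₂' σ) hac hcb hε hk hkev hw hw'c hwc0 hwa hwb hgrowth hφ hbdd heq
  intro σ hσ hσc
  exact sub_eq_zero.1 (hz σ hσ hσc)

/-- **UNIQUENESS OF THE EDGE-MEASURE DENSITY — integrable punctured class.**  The same with «bounded» replaced by «integrable on `S`»,
under the two-sided linear opening of the slip at the waist `κ₁|s − c| ≤ |w(s)| ≤ κ₂|s − c|` (`κ₁ > 0`), `w ≤ 0` left of `c`, `w ≥ 0`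
right of `c`. [folklore] -/
theorem sourced_density_unique_of_integrableOn {a b c cst α ε κ₁ κ₂ : ℝ} (hac : a < c) (hcb : c < b) (hε : 0 < ε)
    (hκ₁ : 0 < κ₁) {k m w w' : ℝ → ℝ} {φ₁ φ₁' φ₂ φ₂' h : ℝ → EuclideanSpace ℝ (Fin 3)} {d e : EuclideanSpace ℝ (Fin 3)}
    (hk : Continuous k) (hkev : ∀ s, k (-s) = k s)
    (hw : ∀ σ, HasDerivAt w (w' σ) σ) (hw'c : Continuous w') (hgrowth : ∀ σ ∈ Icc a b, -1 + 2 * ε ≤ w' σ)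
    (hwlow : ∀ s ∈ Icc a b, κ₁ * |s - c| ≤ |w s|) (hwup : ∀ s ∈ Icc a b, |w s| ≤ κ₂ * |s - c|)
    (hwneg : ∀ s ∈ Ico a c, w s ≤ 0) (hwpos : ∀ s ∈ Ioc c b, 0 ≤ w s)
    (hφ₁ : ∀ σ ∈ Icc a b, σ ≠ c → HasDerivAt φ₁ (φ₁' σ) σ) (hi₁ : IntegrableOn φ₁ (Icc a b))
    (hφ₂ : ∀ σ ∈ Icc a b, σ ≠ c → HasDerivAt φ₂ (φ₂' σ) σ) (hi₂ : IntegrableOn φ₂ (Icc a b))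
    (h₁ : ∀ σ ∈ Icc a b, σ ≠ c →
      cst • (m σ • cross (φ₁ σ) d - ∫ τ in Icc a b, k (τ - σ) • cross (φ₁ τ) d)
        + (1 / 2 : ℝ) • φ₁ σ + α • cross e (φ₁ σ) + w' σ • φ₁ σ + w σ • φ₁' σ = h σ)
    (h₂ : ∀ σ ∈ Icc a b, σ ≠ c →
      cst • (m σ • cross (φ₂ σ) d - ∫ τ in Icc a b, k (τ - σ) • cross (φ₂ τ) d)
        + (1 / 2 : ℝ) • φ₂ σ + α • cross e (φ₂ σ) + w' σ • φ₂ σ + w σ • φ₂' σ = h σ) :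
    ∀ σ ∈ Icc a b, σ ≠ c → φ₁ σ = φ₂ σ := by
  have hφ : ∀ σ ∈ Icc a b, σ ≠ c → HasDerivAt (fun σ => φ₁ σ - φ₂ σ) (φ₁' σ - φ₂' σ) σ :=
    fun σ hσ hσc => (hφ₁ σ hσ hσc).sub (hφ₂ σ hσ hσc)
  have hint : IntegrableOn (fun σ => φ₁ σ - φ₂ σ) (Icc a b) := hi₁.sub hi₂
  have heq : ∀ σ ∈ Icc a b, σ ≠ c →
      cst • (m σ • cross (φ₁ σ - φ₂ σ) d - ∫ τ in Icc a b, k (τ - σ) • cross (φ₁ τ - φ₂ τ) d)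
        + (1 / 2 : ℝ) • (φ₁ σ - φ₂ σ) + α • cross e (φ₁ σ - φ₂ σ) + w' σ • (φ₁ σ - φ₂ σ)
        + w σ • (φ₁' σ - φ₂' σ) = 0 :=
    fun σ hσ hσc => difference_solves_homogeneous
      (integrableOn_nonlocal_integrand_of_integrableOn hk hi₁ d σ)
      (integrableOn_nonlocal_integrand_of_integrableOn hk hi₂ d σ) (h₁ σ hσ hσc) (h₂ σ hσ hσc)
  have hz := model_adjoint_no_integrable_punctured_annihilator (φ := fun σ => φ₁ σ - φ₂ σ)
    (φ' := fun σ => φ₁' σ - φ₂' σ) hac hcb hε hκ₁ hk hkev hw hw'c hgrowth hwlow hwup hwneg hwpos hφ hint heq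
  intro σ hσ hσc
  exact sub_eq_zero.1 (hz σ hσ hσc)

end Summit.NavierStokesRegularity.NavierStokesRegularity.Theorems.Clause13RAdjointPuncturedUnique

end
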